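import Mathlib
import Summits.Ventures.HodgeRepro2.T6N3SideRich
import Summits.Ventures.HodgeRepro2.T6N3DatumRich
import Summits.Ventures.HodgeRepro2.T6N42RichHost

/-!
# T6N42RichSeam — THE SEAM TYPE-CHECKED ON d3's ACTUAL CARRIERS: the N4.2 host instance shape
(`T6N42RichHost.lean`) over a side `X : N3SideRich LG Gf` of t6-p3's rich host datum
`N3DatumRich` (owner t6-p5; imports t6-p3's T6N3SideRich / T6N3DatumRich and this seat's
T6N42RichHost)

`T6N42FlathLiftHost.FirstLiftSide LH Hf R π₀` was written over the N3 side's carrier TYPES read off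
t6-p3's staged `N3SideRich` (memo §12). This file is the kernel's confirmation that the seam is
real: for an actual `X : N3SideRich LG Gf`, `FirstLiftSide X.LH X.Hf X.R X.π₀` TYPE-CHECKS — the
instance fields of `X` (`NormedAddCommGroup X.LH`, `InnerProductSpace ℂ X.LH`, `Group X.Hf`) are
found through t6-p3's instance projections, `X.R : X.Hf → X.LH →ₗᵢ[ℂ] X.LH` and
`X.π₀ : Submodule ℂ X.LH` are exactly the parameters the seam expects — and the N4.2 rich datum of a
side of the host datum is `N3SideRich.n42Rich X F hF S hS` (= `N42Rich.ofHost`), with both sides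
`N3DatumRich.n42RichA` / `n42RichB` of an `Rd : N3DatumRich`. Nothing is constructed: the host's
N4.2 obligation per side stays 2 DATA (`F : X.FirstLiftSideOn`, `S : X.HostReadingsOn D F hF`)
+ 2 RESIDUAL (`hF`, `hS`) + the two displays (`T6N42RichHost.lean`); the C8 caveat (d3's objects
do not exist as Lean terms) is unchanged. No joint toy here: the joint toy of the seam is
`T6N42RichSeamToy.lean` (on t6-p3's `T6N3SideRichToy`, both in the tree since WAVE 1).

Proof lane (`abbrev`s, `def`s, one `rfl` theorem per side; no display — nothing here is a printed
statement). README §8(d): uses an L-value-free non-vanishing device: NO (TIER5 §N4.2 / §B,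
pre-02:16Z lines of record, continued).

Filed in Tier-6 WAVE 1 as p438959 (proposed 2026-08-26T10:46:21Z, ACCEPTED, commit 9c09fd3e5e58);
this v2 differs from the filed bytes in this module docstring only (the staged-record wording
dropped; every declaration byte-identical to v1).
-/

namespace Summit.Ventures.HodgeRepro2.T6

open Summit.Ventures.HodgeRepro2
open Summit.Ventures.HodgeRepro2.T6.N42Datum
open Summit.Ventures.HodgeRepro2.T6.N42Flath

section Side

variable {LG : Type} [NormedAddCommGroup LG] [InnerProductSpace ℂ LG] [CompleteSpace LG]
  {Gf : Type} [Group Gf]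

/-- The first-lift side (TIER5 (E1) as data) over an actual N3 side's carriers `L²([H])`, `H(𝔸_f)`,
the right translation and `π₀ ⊂ L²([H])`. -/
abbrev N3SideRich.FirstLiftSideOn (X : N3SideRich LG Gf) :=
  FirstLiftSide X.LH X.Hf X.R X.π₀

/-- The host readings of a finite-places datum over an actual N3 side, for a first-lift side `F` on
its carriers under its laws `hF`. -/
abbrev N3SideRich.HostReadingsOn (X : N3SideRich LG Gf) (D : FinitePlacesDatum)
    (F : X.FirstLiftSideOn) (hF : F.IsLift) :=
  HostReadings D F hF

/-- THE N4.2 RICH DATUM OF AN N3 SIDE: `N42Rich.ofHost` on the side's carriers. -/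
def N3SideRich.n42Rich (X : N3SideRich LG Gf) {D : FinitePlacesDatum} (F : X.FirstLiftSideOn)
    (hF : F.IsLift) (S : X.HostReadingsOn D F hF) (hS : S.IsReading) : N42Rich :=
  N42Rich.ofHost F hF S hS

/-- Its datum is `D` (`rfl`). -/
theorem N3SideRich.n42Rich_toDatum (X : N3SideRich LG Gf) {D : FinitePlacesDatum}
    (F : X.FirstLiftSideOn) (hF : F.IsLift) (S : X.HostReadingsOn D F hF) (hS : S.IsReading) :
    (X.n42Rich F hF S hS).toDatum = D := rfl

/-- `N42_main` on an N3 side from the host objects: the two displays give `ThetaNonzeroEverywhere`. -/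
theorem N3SideRich.thetaNonzeroEverywhere (X : N3SideRich LG Gf) {D : FinitePlacesDatum}
    (F : X.FirstLiftSideOn) (hF : F.IsLift) (S : X.HostReadingsOn D F hF) (hS : S.IsReading)
    (hM : ∀ v, Hyp.Minguez2008_Theoreme1_2 (D.splitDatum v))
    (hGI : ∀ v, Hyp.GanIchino2014_Prop5_3_i (D.towerDatum v)) : D.ThetaNonzeroEverywhere :=
  (X.n42Rich F hF S hS).thetaNonzeroEverywhere hM hGI

end Side

section Datum

/-- THE N4.2 RICH DATUM OF SIDE A OF THE HOST DATUM. -/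
def N3DatumRich.n42RichA (Rd : N3DatumRich) {D : FinitePlacesDatum} (F : Rd.A.FirstLiftSideOn)
    (hF : F.IsLift) (S : Rd.A.HostReadingsOn D F hF) (hS : S.IsReading) : N42Rich :=
  Rd.A.n42Rich F hF S hS

/-- THE N4.2 RICH DATUM OF SIDE B OF THE HOST DATUM. -/
def N3DatumRich.n42RichB (Rd : N3DatumRich) {D : FinitePlacesDatum} (F : Rd.B.FirstLiftSideOn)
    (hF : F.IsLift) (S : Rd.B.HostReadingsOn D F hF) (hS : S.IsReading) : N42Rich :=
  Rd.B.n42Rich F hF S hS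

/-- Side A's datum is `D` (`rfl`). -/
theorem N3DatumRich.n42RichA_toDatum (Rd : N3DatumRich) {D : FinitePlacesDatum}
    (F : Rd.A.FirstLiftSideOn) (hF : F.IsLift) (S : Rd.A.HostReadingsOn D F hF)
    (hS : S.IsReading) : (Rd.n42RichA F hF S hS).toDatum = D := rfl

/-- Side B's datum is `D` (`rfl`). -/
theorem N3DatumRich.n42RichB_toDatum (Rd : N3DatumRich) {D : FinitePlacesDatum}
    (F : Rd.B.FirstLiftSideOn) (hF : F.IsLift) (S : Rd.B.HostReadingsOn D F hF)
    (hS : S.IsReading) : (Rd.n42RichB F hF S hS).toDatum = D := rfl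

end Datum

end Summit.Ventures.HodgeRepro2.T6
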